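import Literature.MathematicalPhysics.StatisticalMechanics.BarlowCoordination
import HarnessLib

/-!
# Layer combinatorics of Barlow stackings: rhombi, apexes and hollow letters

HONEST FRAMING. Part of the venture `Summits/Ventures/Crystal3D` (cells `pub-crystal3d`,
`crystal3d-full`). Finite combinatorics of the in-layer / adjacent-layer contact offsets
`sixOffsets`, `threeOffsets (±1)` of `BarlowCoordination.lean` (touching stackings
`barlowStacking a h σ`, `h² = ⅔a²`, any Hägg sequence), all by `decide` on the offset tables and
then transported to absolute in-layer coordinates. They are the case lemmas of the bipyramid-axis
lemma (eng LEMMA 1 of the cell `crystal3d-full`, file `BarlowBipyramidAxis.lean`):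

* `no_rhombus_below_apex`, `no_rhombus_above_apex` — a site of an adjacent layer touches at most
  three sites of a layer, so it cannot touch the four sites of a contact rhombus (two in-layer
  triangles sharing an edge);
* `apex_above_unique`, `apex_below_unique` — an in-layer contact triangle has at most one touching
  site in the layer above and at most one in the layer below;
* `hollow_letters_ne` — if an in-layer triangle has a touching site above (letter shift `τ`) AND
  one below (letter shift `τ'` read downwards), then `τ ≠ τ'`: a triangle covered on both sides is
  an `h`-layer triangle (`σ (l−1) ≠ σ l`).

WHAT THIS IS NOT: nothing off-lattice; no statement about ground states.
-/

noncomputable section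

namespace Summit.Ventures.Crystal3D

open Literature.MathematicalPhysics.StatisticalMechanics (sixOffsets threeOffsets)

/-! ## Offset versions (`decide`) -/

/-- Four adjacent-layer offsets from one site cannot form a contact rhombus (three of the five
rhombus edges plus distinct far corners), letter shift `+1`. -/
theorem rhombus_offsets_pos :
    ∀ x ∈ threeOffsets 1, ∀ y ∈ threeOffsets 1, ∀ z ∈ threeOffsets 1, ∀ w ∈ threeOffsets 1,
      x - y ∈ sixOffsets → x - z ∈ sixOffsets → x - w ∈ sixOffsets → y - z ∈ sixOffsets →
        y - w ∈ sixOffsets → z ≠ w → False := by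
  decide

/-- The same for letter shift `−1`. -/
theorem rhombus_offsets_neg :
    ∀ x ∈ threeOffsets (-1), ∀ y ∈ threeOffsets (-1), ∀ z ∈ threeOffsets (-1),
      ∀ w ∈ threeOffsets (-1),
      x - y ∈ sixOffsets → x - z ∈ sixOffsets → x - w ∈ sixOffsets → y - z ∈ sixOffsets →
        y - w ∈ sixOffsets → z ≠ w → False := by
  decide

/-- An in-layer triangle `0, u, v` has at most one apex offset `x` above it (`x, x−u, x−v` all
adjacent-layer offsets), letter shift `+1`. -/
theorem apex_offsets_unique_pos :
    ∀ u ∈ sixOffsets, ∀ v ∈ sixOffsets, v - u ∈ sixOffsets →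
      ∀ x ∈ threeOffsets 1, x - u ∈ threeOffsets 1 → x - v ∈ threeOffsets 1 →
      ∀ y ∈ threeOffsets 1, y - u ∈ threeOffsets 1 → y - v ∈ threeOffsets 1 → x = y := by
  decide

/-- The same for letter shift `−1`. -/
theorem apex_offsets_unique_neg :
    ∀ u ∈ sixOffsets, ∀ v ∈ sixOffsets, v - u ∈ sixOffsets →
      ∀ x ∈ threeOffsets (-1), x - u ∈ threeOffsets (-1) → x - v ∈ threeOffsets (-1) →
      ∀ y ∈ threeOffsets (-1), y - u ∈ threeOffsets (-1) → y - v ∈ threeOffsets (-1) →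
        x = y := by
  decide

/-- Apex BELOW an in-layer triangle (offsets `X, X+u, X+v` from the apex up to the triangle),
letter shift `+1`: unique. -/
theorem apexBelow_offsets_unique_pos :
    ∀ u ∈ sixOffsets, ∀ v ∈ sixOffsets, v - u ∈ sixOffsets →
      ∀ x ∈ threeOffsets 1, x + u ∈ threeOffsets 1 → x + v ∈ threeOffsets 1 →
      ∀ y ∈ threeOffsets 1, y + u ∈ threeOffsets 1 → y + v ∈ threeOffsets 1 → x = y := by
  decide

/-- The same for letter shift `−1`. -/
theorem apexBelow_offsets_unique_neg :
    ∀ u ∈ sixOffsets, ∀ v ∈ sixOffsets, v - u ∈ sixOffsets →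
      ∀ x ∈ threeOffsets (-1), x + u ∈ threeOffsets (-1) → x + v ∈ threeOffsets (-1) →
      ∀ y ∈ threeOffsets (-1), y + u ∈ threeOffsets (-1) → y + v ∈ threeOffsets (-1) →
        x = y := by
  decide

/-- **Hollow letters.** If the triangle `0, u, v` has an apex above with letter shift `τ` (offsets
`x, x−u, x−v ∈ threeOffsets τ`) and an apex below read with letter shift `τ'` (offsets
`y, y+u, y+v ∈ threeOffsets τ'`), then `τ ≠ τ'` (for `τ, τ' ∈ {1, −1}`): the two shifts see the
triangle as an up- resp. down-triangle. -/
theorem hollow_offsets_letters_ne (τ τ' : ℤ) (hτ : τ = 1 ∨ τ = -1) (hτ' : τ' = 1 ∨ τ' = -1) :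
    ∀ u ∈ sixOffsets, ∀ v ∈ sixOffsets, v - u ∈ sixOffsets →
      ∀ x ∈ threeOffsets τ, x - u ∈ threeOffsets τ → x - v ∈ threeOffsets τ →
      ∀ y ∈ threeOffsets τ', y + u ∈ threeOffsets τ' → y + v ∈ threeOffsets τ' → τ ≠ τ' := by
  rcases hτ with rfl | rfl <;> rcases hτ' with rfl | rfl <;> decide

/-! ## Absolute in-layer coordinates -/

section Absolute

variable (τ : ℤ) (hτ : τ = 1 ∨ τ = -1)
include hτ

/-- **No contact rhombus below an apex.** A site `c` of layer `l + 1` cannot touch four sites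
`p, q, r, s` of layer `l` (`r ≠ s`) among which `pq, pr, ps, qr, qs` touch: offsets
`(i_p − i_c, j_p − j_c) ∈ threeOffsets τ` etc. (`τ = −σ l`). -/
theorem no_rhombus_below_apex (ic jc ip jp iq jq ir jr is js : ℤ)
    (hp : (ip - ic, jp - jc) ∈ threeOffsets τ) (hq : (iq - ic, jq - jc) ∈ threeOffsets τ)
    (hr : (ir - ic, jr - jc) ∈ threeOffsets τ) (hs : (is - ic, js - jc) ∈ threeOffsets τ)
    (hpq : (ip - iq, jp - jq) ∈ sixOffsets) (hpr : (ip - ir, jp - jr) ∈ sixOffsets)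
    (hps : (ip - is, jp - js) ∈ sixOffsets) (hqr : (iq - ir, jq - jr) ∈ sixOffsets)
    (hqs : (iq - is, jq - js) ∈ sixOffsets) (hrs : (ir, jr) ≠ (is, js)) : False := by
  have e : ∀ a b a' b' : ℤ, ((a - a', b - b') : ℤ × ℤ) = (a - ic, b - jc) - (a' - ic, b' - jc) :=
    fun a b a' b' => by simp only [Prod.mk_sub_mk, sub_sub_sub_cancel_right]
  rw [e] at hpq hpr hps hqr hqs
  have hne : ((ir - ic, jr - jc) : ℤ × ℤ) ≠ (is - ic, js - jc) := by
    intro h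
    simp only [Prod.mk.injEq] at h
    exact hrs (by rw [show ir = is by omega, show jr = js by omega])
  rcases hτ with rfl | rfl
  · exact rhombus_offsets_pos _ hp _ hq _ hr _ hs hpq hpr hps hqr hqs hne
  · exact rhombus_offsets_neg _ hp _ hq _ hr _ hs hpq hpr hps hqr hqs hne

/-- **No contact rhombus above an apex.** A site `c` of layer `l − 1` cannot touch four sites
`p, q, r, s` of layer `l` (`r ≠ s`) among which `pq, pr, ps, qr, qs` touch: offsets
`(i_c − i_p, j_c − j_p) ∈ threeOffsets τ` etc. (`τ = −σ (l − 1)`). -/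
theorem no_rhombus_above_apex (ic jc ip jp iq jq ir jr is js : ℤ)
    (hp : (ic - ip, jc - jp) ∈ threeOffsets τ) (hq : (ic - iq, jc - jq) ∈ threeOffsets τ)
    (hr : (ic - ir, jc - jr) ∈ threeOffsets τ) (hs : (ic - is, jc - js) ∈ threeOffsets τ)
    (hqp : (iq - ip, jq - jp) ∈ sixOffsets) (hrp : (ir - ip, jr - jp) ∈ sixOffsets)
    (hsp : (is - ip, js - jp) ∈ sixOffsets) (hrq : (ir - iq, jr - jq) ∈ sixOffsets)
    (hsq : (is - iq, js - jq) ∈ sixOffsets) (hrs : (ir, jr) ≠ (is, js)) : False := by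
  have e : ∀ a b a' b' : ℤ, ((a' - a, b' - b) : ℤ × ℤ) = (ic - a, jc - b) - (ic - a', jc - b') :=
    fun a b a' b' => by simp only [Prod.mk_sub_mk, sub_sub_sub_cancel_left]
  rw [e] at hqp hrp hsp hrq hsq
  have hne : ((ic - ir, jc - jr) : ℤ × ℤ) ≠ (ic - is, jc - js) := by
    intro h
    simp only [Prod.mk.injEq] at h
    exact hrs (by rw [show ir = is by omega, show jr = js by omega])
  rcases hτ with rfl | rfl
  · exact rhombus_offsets_pos _ hp _ hq _ hr _ hs hqp hrp hsp hrq hsq hne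
  · exact rhombus_offsets_neg _ hp _ hq _ hr _ hs hqp hrp hsp hrq hsq hne

/-- **At most one apex above a triangle.** If sites `3` and `4` of layer `l + 1` both touch the
three sites `0, 1, 2` of an in-layer contact triangle of layer `l`, they have the same in-layer
coordinates. -/
theorem apex_above_unique (i₀ j₀ i₁ j₁ i₂ j₂ i₃ j₃ i₄ j₄ : ℤ)
    (h01 : (i₀ - i₁, j₀ - j₁) ∈ sixOffsets) (h02 : (i₀ - i₂, j₀ - j₂) ∈ sixOffsets)
    (h12 : (i₁ - i₂, j₁ - j₂) ∈ sixOffsets)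
    (h03 : (i₀ - i₃, j₀ - j₃) ∈ threeOffsets τ) (h13 : (i₁ - i₃, j₁ - j₃) ∈ threeOffsets τ)
    (h23 : (i₂ - i₃, j₂ - j₃) ∈ threeOffsets τ)
    (h04 : (i₀ - i₄, j₀ - j₄) ∈ threeOffsets τ) (h14 : (i₁ - i₄, j₁ - j₄) ∈ threeOffsets τ)
    (h24 : (i₂ - i₄, j₂ - j₄) ∈ threeOffsets τ) : i₃ = i₄ ∧ j₃ = j₄ := by
  have e : ∀ a b a' b' : ℤ, ((a - a', b - b') : ℤ × ℤ) = (i₀ - a', j₀ - b') - (i₀ - a, j₀ - b) :=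
    fun a b a' b' => by simp only [Prod.mk_sub_mk, sub_sub_sub_cancel_left]
  rw [e] at h12 h13 h23 h14 h24
  have h : ((i₀ - i₃, j₀ - j₃) : ℤ × ℤ) = (i₀ - i₄, j₀ - j₄) := by
    rcases hτ with rfl | rfl
    · exact apex_offsets_unique_pos _ h01 _ h02 h12 _ h03 h13 h23 _ h04 h14 h24
    · exact apex_offsets_unique_neg _ h01 _ h02 h12 _ h03 h13 h23 _ h04 h14 h24
  simp only [Prod.mk.injEq] at h
  constructor <;> omega

/-- **At most one apex below a triangle.** If sites `3` and `4` of layer `l − 1` both touch the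
three sites `0, 1, 2` of an in-layer contact triangle of layer `l` (offsets
`(i₃ − i_m, j₃ − j_m) ∈ threeOffsets τ`, `τ = −σ (l−1)`), they have the same in-layer coordinates. -/
theorem apex_below_unique (i₀ j₀ i₁ j₁ i₂ j₂ i₃ j₃ i₄ j₄ : ℤ)
    (h01 : (i₀ - i₁, j₀ - j₁) ∈ sixOffsets) (h02 : (i₀ - i₂, j₀ - j₂) ∈ sixOffsets)
    (h12 : (i₁ - i₂, j₁ - j₂) ∈ sixOffsets)
    (h30 : (i₃ - i₀, j₃ - j₀) ∈ threeOffsets τ) (h31 : (i₃ - i₁, j₃ - j₁) ∈ threeOffsets τ)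
    (h32 : (i₃ - i₂, j₃ - j₂) ∈ threeOffsets τ)
    (h40 : (i₄ - i₀, j₄ - j₀) ∈ threeOffsets τ) (h41 : (i₄ - i₁, j₄ - j₁) ∈ threeOffsets τ)
    (h42 : (i₄ - i₂, j₄ - j₂) ∈ threeOffsets τ) : i₃ = i₄ ∧ j₃ = j₄ := by
  have e12 : ((i₁ - i₂, j₁ - j₂) : ℤ × ℤ) = (i₀ - i₂, j₀ - j₂) - (i₀ - i₁, j₀ - j₁) := by
    simp only [Prod.mk_sub_mk, sub_sub_sub_cancel_left]
  have e : ∀ a b a' b' : ℤ, ((a - a', b - b') : ℤ × ℤ) = (a - i₀, b - j₀) + (i₀ - a', j₀ - b') :=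
    fun a b a' b' => by simp only [Prod.mk_add_mk, sub_add_sub_cancel]
  rw [e12] at h12
  rw [e] at h31 h32 h41 h42
  have h : ((i₃ - i₀, j₃ - j₀) : ℤ × ℤ) = (i₄ - i₀, j₄ - j₀) := by
    rcases hτ with rfl | rfl
    · exact apexBelow_offsets_unique_pos _ h01 _ h02 h12 _ h30 h31 h32 _ h40 h41 h42
    · exact apexBelow_offsets_unique_neg _ h01 _ h02 h12 _ h30 h31 h32 _ h40 h41 h42
  simp only [Prod.mk.injEq] at h
  constructor <;> omega

omit hτ in
/-- **Hollow letters differ.** If the in-layer contact triangle `0, 1, 2` of layer `l` has a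
touching site `3` in layer `l + 1` (offsets in `threeOffsets τ`, `τ = −σ l`) and a touching site
`4` in layer `l − 1` (offsets `(i₄ − i_m, j₄ − j_m) ∈ threeOffsets τ'`, `τ' = −σ (l−1)`), then
`τ ≠ τ'`; with `σ` a Hägg sequence this says `σ (l − 1) ≠ σ l` (the triangle's layer is an
`h`-layer). -/
theorem hollow_letters_ne (τ' : ℤ) (hτ : τ = 1 ∨ τ = -1) (hτ' : τ' = 1 ∨ τ' = -1)
    (i₀ j₀ i₁ j₁ i₂ j₂ i₃ j₃ i₄ j₄ : ℤ)
    (h01 : (i₀ - i₁, j₀ - j₁) ∈ sixOffsets) (h02 : (i₀ - i₂, j₀ - j₂) ∈ sixOffsets)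
    (h12 : (i₁ - i₂, j₁ - j₂) ∈ sixOffsets)
    (h03 : (i₀ - i₃, j₀ - j₃) ∈ threeOffsets τ) (h13 : (i₁ - i₃, j₁ - j₃) ∈ threeOffsets τ)
    (h23 : (i₂ - i₃, j₂ - j₃) ∈ threeOffsets τ)
    (h40 : (i₄ - i₀, j₄ - j₀) ∈ threeOffsets τ') (h41 : (i₄ - i₁, j₄ - j₁) ∈ threeOffsets τ')
    (h42 : (i₄ - i₂, j₄ - j₂) ∈ threeOffsets τ') : τ ≠ τ' := by
  have e12 : ((i₁ - i₂, j₁ - j₂) : ℤ × ℤ) = (i₀ - i₂, j₀ - j₂) - (i₀ - i₁, j₀ - j₁) := by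
    simp only [Prod.mk_sub_mk, sub_sub_sub_cancel_left]
  have e : ∀ a b a' b' : ℤ, ((a - a', b - b') : ℤ × ℤ) = (i₀ - a', j₀ - b') - (i₀ - a, j₀ - b) :=
    fun a b a' b' => by simp only [Prod.mk_sub_mk, sub_sub_sub_cancel_left]
  have e' : ∀ a b a' b' : ℤ, ((a - a', b - b') : ℤ × ℤ) = (a - i₀, b - j₀) + (i₀ - a', j₀ - b') :=
    fun a b a' b' => by simp only [Prod.mk_add_mk, sub_add_sub_cancel]
  rw [e12] at h12
  rw [e] at h13 h23
  rw [e'] at h41 h42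
  exact hollow_offsets_letters_ne τ τ' hτ hτ' _ h01 _ h02 h12 _ h03 h13 h23 _ h40 h41 h42

end Absolute

end Summit.Ventures.Crystal3D

end
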